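import Mathlib
import HarnessLib
import Summits.RiemannHypothesis.RiemannHypothesis.Theorems.DbrWallLogTableD

/-!
# DBR column, rung B-P(P1): two-sided rational enclosures of `log p`, primes `p ≤ 457` (part E: 349 ≤ p ≤ 457)

RH-FREE elementary inequalities (LINE 1 of the label discipline): for each prime `p` in range a lemma
`log_<p>_bounds : lo < Real.log p ∧ Real.log p < hi` with 13-decimal rational `lo, hi` (widths `≤ 1e-12`),
each obtained from Mathlib's `Real.abs_log_sub_add_sum_range_le` (the logarithmic series with remainder)
applied to `log(p/N)` for a smooth neighbour `N` of `p`, plus the bounds already proved for the primes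
dividing `N`. They feed the generic anti-persistence rung certificate (`DbrWallRungKit`): the prime terms
`Λ(n)n^{-1/2}(log q' − log n)` of the two-point gap `2Ψ(s) − Ψ(2s)` at `s = (log q')/2` are bounded below
from these enclosures. Nothing here bears on the truth of RH. [folklore]
-/

set_option linter.dupNamespace false

noncomputable section

namespace Summit.RiemannHypothesis.RiemannHypothesis.Theorems.DbrWall.LogTable

/-- `5.8550719222018 < log 349 < 5.8550719222033` (from `log(347 / 349)` by 6 terms of the logarithmic series; width 1.5e-12). [folklore] -/
theorem log_349_bounds : (5.8550719222018 : ℝ) < Real.log 349 ∧ Real.log 349 < 5.8550719222033 := by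
  have hx : |(2 / 349 : ℝ)| < 1 := by rw [abs_of_pos (by norm_num)]; norm_num
  have h := Real.abs_log_sub_add_sum_range_le hx 6
  have e : Real.log (1 - 2 / 349 : ℝ) = (Real.log 347) - Real.log 349 := by
    rw [show (1 - 2 / 349 : ℝ) = (347 : ℝ) / 349 by norm_num, Real.log_div (by norm_num) (by norm_num)]
  rw [e, abs_of_pos (by norm_num : (0:ℝ) < 2 / 349)] at h
  obtain ⟨hl, hu⟩ := abs_le.1 h
  simp only [Finset.sum_range_succ, Finset.sum_range_zero] at hl hu
  norm_num at hl hu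
  have hb347 := log_347_bounds
  constructor <;> linarith

/-- `5.8664680569328 < log 353 < 5.8664680569340` (from `log(352 / 353)` by 5 terms of the logarithmic series; width 1.2e-12). [folklore] -/
theorem log_353_bounds : (5.8664680569328 : ℝ) < Real.log 353 ∧ Real.log 353 < 5.8664680569340 := by
  have hx : |(1 / 353 : ℝ)| < 1 := by rw [abs_of_pos (by norm_num)]; norm_num
  have h := Real.abs_log_sub_add_sum_range_le hx 5
  have hN : Real.log (352 : ℝ) = 5 * Real.log 2 + Real.log 11 := by
    rw [show (352 : ℝ) = 2 ^ 5 * 11 by norm_num]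
    rw [Real.log_mul (by positivity) (by positivity)]
    simp only [Real.log_pow]; push_cast; ring
  have e : Real.log (1 - 1 / 353 : ℝ) = (5 * Real.log 2 + Real.log 11) - Real.log 353 := by
    rw [show (1 - 1 / 353 : ℝ) = (352 : ℝ) / 353 by norm_num, Real.log_div (by norm_num) (by norm_num), hN]
  rw [e, abs_of_pos (by norm_num : (0:ℝ) < 1 / 353)] at h
  obtain ⟨hl, hu⟩ := abs_le.1 h
  simp only [Finset.sum_range_succ, Finset.sum_range_zero] at hl hu
  norm_num at hl hu
  have hb2 := log_two_bounds
  have hb11 := log_eleven_bounds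
  constructor <;> linarith

/-- `5.8833223884877 < log 359 < 5.8833223884890` (from `log(358 / 359)` by 5 terms of the logarithmic series; width 1.3e-12). [folklore] -/
theorem log_359_bounds : (5.8833223884877 : ℝ) < Real.log 359 ∧ Real.log 359 < 5.8833223884890 := by
  have hx : |(1 / 359 : ℝ)| < 1 := by rw [abs_of_pos (by norm_num)]; norm_num
  have h := Real.abs_log_sub_add_sum_range_le hx 5
  have hN : Real.log (358 : ℝ) = Real.log 2 + Real.log 179 := by
    rw [show (358 : ℝ) = 2 * 179 by norm_num]
    rw [Real.log_mul (by positivity) (by positivity)]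
  have e : Real.log (1 - 1 / 359 : ℝ) = (Real.log 2 + Real.log 179) - Real.log 359 := by
    rw [show (1 - 1 / 359 : ℝ) = (358 : ℝ) / 359 by norm_num, Real.log_div (by norm_num) (by norm_num), hN]
  rw [e, abs_of_pos (by norm_num : (0:ℝ) < 1 / 359)] at h
  obtain ⟨hl, hu⟩ := abs_le.1 h
  simp only [Finset.sum_range_succ, Finset.sum_range_zero] at hl hu
  norm_num at hl hu
  have hb2 := log_two_bounds
  have hb179 := log_179_bounds
  constructor <;> linarith

/-- `5.9053618480541 < log 367 < 5.9053618480553` (from `log(367 / 368)` by 5 terms of the logarithmic series; width 1.2e-12). [folklore] -/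
theorem log_367_bounds : (5.9053618480541 : ℝ) < Real.log 367 ∧ Real.log 367 < 5.9053618480553 := by
  have hx : |(1 / 368 : ℝ)| < 1 := by rw [abs_of_pos (by norm_num)]; norm_num
  have h := Real.abs_log_sub_add_sum_range_le hx 5
  have hN : Real.log (368 : ℝ) = 4 * Real.log 2 + Real.log 23 := by
    rw [show (368 : ℝ) = 2 ^ 4 * 23 by norm_num]
    rw [Real.log_mul (by positivity) (by positivity)]
    simp only [Real.log_pow]; push_cast; ring
  have e : Real.log (1 - 1 / 368 : ℝ) = Real.log 367 - (4 * Real.log 2 + Real.log 23) := by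
    rw [show (1 - 1 / 368 : ℝ) = (367 : ℝ) / 368 by norm_num, Real.log_div (by norm_num) (by norm_num), hN]
  rw [e, abs_of_pos (by norm_num : (0:ℝ) < 1 / 368)] at h
  obtain ⟨hl, hu⟩ := abs_le.1 h
  simp only [Finset.sum_range_succ, Finset.sum_range_zero] at hl hu
  norm_num at hl hu
  have hb2 := log_two_bounds
  have hb23 := log_twentythree_bounds
  constructor <;> linarith

/-- `5.9215784196433 < log 373 < 5.9215784196445` (from `log(372 / 373)` by 5 terms of the logarithmic series; width 1.2e-12). [folklore] -/
theorem log_373_bounds : (5.9215784196433 : ℝ) < Real.log 373 ∧ Real.log 373 < 5.9215784196445 := by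
  have hx : |(1 / 373 : ℝ)| < 1 := by rw [abs_of_pos (by norm_num)]; norm_num
  have h := Real.abs_log_sub_add_sum_range_le hx 5
  have hN : Real.log (372 : ℝ) = 2 * Real.log 2 + Real.log 3 + Real.log 31 := by
    rw [show (372 : ℝ) = 2 ^ 2 * 3 * 31 by norm_num]
    rw [Real.log_mul (by positivity) (by positivity), Real.log_mul (by positivity) (by positivity)]
    simp only [Real.log_pow]; push_cast; ring
  have e : Real.log (1 - 1 / 373 : ℝ) = (2 * Real.log 2 + Real.log 3 + Real.log 31) - Real.log 373 := by
    rw [show (1 - 1 / 373 : ℝ) = (372 : ℝ) / 373 by norm_num, Real.log_div (by norm_num) (by norm_num), hN]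
  rw [e, abs_of_pos (by norm_num : (0:ℝ) < 1 / 373)] at h
  obtain ⟨hl, hu⟩ := abs_le.1 h
  simp only [Finset.sum_range_succ, Finset.sum_range_zero] at hl hu
  norm_num at hl hu
  have hb2 := log_two_bounds
  have hb3 := log_three_bounds
  have hb31 := log_thirtyone_bounds
  constructor <;> linarith

/-- `5.9375362050818 < log 379 < 5.9375362050833` (from `log(378 / 379)` by 5 terms of the logarithmic series; width 1.5e-12). [folklore] -/
theorem log_379_bounds : (5.9375362050818 : ℝ) < Real.log 379 ∧ Real.log 379 < 5.9375362050833 := by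
  have hx : |(1 / 379 : ℝ)| < 1 := by rw [abs_of_pos (by norm_num)]; norm_num
  have h := Real.abs_log_sub_add_sum_range_le hx 5
  have hN : Real.log (378 : ℝ) = Real.log 2 + 3 * Real.log 3 + Real.log 7 := by
    rw [show (378 : ℝ) = 2 * 3 ^ 3 * 7 by norm_num]
    rw [Real.log_mul (by positivity) (by positivity), Real.log_mul (by positivity) (by positivity)]
    simp only [Real.log_pow]; push_cast; ring
  have e : Real.log (1 - 1 / 379 : ℝ) = (Real.log 2 + 3 * Real.log 3 + Real.log 7) - Real.log 379 := by
    rw [show (1 - 1 / 379 : ℝ) = (378 : ℝ) / 379 by norm_num, Real.log_div (by norm_num) (by norm_num), hN]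
  rw [e, abs_of_pos (by norm_num : (0:ℝ) < 1 / 379)] at h
  obtain ⟨hl, hu⟩ := abs_le.1 h
  simp only [Finset.sum_range_succ, Finset.sum_range_zero] at hl hu
  norm_num at hl hu
  have hb2 := log_two_bounds
  have hb3 := log_three_bounds
  have hb7 := log_seven_bounds
  constructor <;> linarith

/-- `5.9480349891801 < log 383 < 5.9480349891813` (from `log(382 / 383)` by 5 terms of the logarithmic series; width 1.2e-12). [folklore] -/
theorem log_383_bounds : (5.9480349891801 : ℝ) < Real.log 383 ∧ Real.log 383 < 5.9480349891813 := by
  have hx : |(1 / 383 : ℝ)| < 1 := by rw [abs_of_pos (by norm_num)]; norm_num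
  have h := Real.abs_log_sub_add_sum_range_le hx 5
  have hN : Real.log (382 : ℝ) = Real.log 2 + Real.log 191 := by
    rw [show (382 : ℝ) = 2 * 191 by norm_num]
    rw [Real.log_mul (by positivity) (by positivity)]
  have e : Real.log (1 - 1 / 383 : ℝ) = (Real.log 2 + Real.log 191) - Real.log 383 := by
    rw [show (1 - 1 / 383 : ℝ) = (382 : ℝ) / 383 by norm_num, Real.log_div (by norm_num) (by norm_num), hN]
  rw [e, abs_of_pos (by norm_num : (0:ℝ) < 1 / 383)] at h
  obtain ⟨hl, hu⟩ := abs_le.1 h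
  simp only [Finset.sum_range_succ, Finset.sum_range_zero] at hl hu
  norm_num at hl hu
  have hb2 := log_two_bounds
  have hb191 := log_191_bounds
  constructor <;> linarith

/-- `5.9635793436179 < log 389 < 5.9635793436191` (from `log(388 / 389)` by 5 terms of the logarithmic series; width 1.2e-12). [folklore] -/
theorem log_389_bounds : (5.9635793436179 : ℝ) < Real.log 389 ∧ Real.log 389 < 5.9635793436191 := by
  have hx : |(1 / 389 : ℝ)| < 1 := by rw [abs_of_pos (by norm_num)]; norm_num
  have h := Real.abs_log_sub_add_sum_range_le hx 5
  have hN : Real.log (388 : ℝ) = 2 * Real.log 2 + Real.log 97 := by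
    rw [show (388 : ℝ) = 2 ^ 2 * 97 by norm_num]
    rw [Real.log_mul (by positivity) (by positivity)]
    simp only [Real.log_pow]; push_cast; ring
  have e : Real.log (1 - 1 / 389 : ℝ) = (2 * Real.log 2 + Real.log 97) - Real.log 389 := by
    rw [show (1 - 1 / 389 : ℝ) = (388 : ℝ) / 389 by norm_num, Real.log_div (by norm_num) (by norm_num), hN]
  rw [e, abs_of_pos (by norm_num : (0:ℝ) < 1 / 389)] at h
  obtain ⟨hl, hu⟩ := abs_le.1 h
  simp only [Finset.sum_range_succ, Finset.sum_range_zero] at hl hu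
  norm_num at hl hu
  have hb2 := log_two_bounds
  have hb97 := log_ninetyseven_bounds
  constructor <;> linarith

/-- `5.9839362806867 < log 397 < 5.9839362806879` (from `log(397 / 398)` by 5 terms of the logarithmic series; width 1.2e-12). [folklore] -/
theorem log_397_bounds : (5.9839362806867 : ℝ) < Real.log 397 ∧ Real.log 397 < 5.9839362806879 := by
  have hx : |(1 / 398 : ℝ)| < 1 := by rw [abs_of_pos (by norm_num)]; norm_num
  have h := Real.abs_log_sub_add_sum_range_le hx 5
  have hN : Real.log (398 : ℝ) = Real.log 2 + Real.log 199 := by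
    rw [show (398 : ℝ) = 2 * 199 by norm_num]
    rw [Real.log_mul (by positivity) (by positivity)]
  have e : Real.log (1 - 1 / 398 : ℝ) = Real.log 397 - (Real.log 2 + Real.log 199) := by
    rw [show (1 - 1 / 398 : ℝ) = (397 : ℝ) / 398 by norm_num, Real.log_div (by norm_num) (by norm_num), hN]
  rw [e, abs_of_pos (by norm_num : (0:ℝ) < 1 / 398)] at h
  obtain ⟨hl, hu⟩ := abs_le.1 h
  simp only [Finset.sum_range_succ, Finset.sum_range_zero] at hl hu
  norm_num at hl hu
  have hb2 := log_two_bounds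
  have hb199 := log_199_bounds
  constructor <;> linarith

/-- `5.9939614273061 < log 401 < 5.9939614273072` (from `log(400 / 401)` by 5 terms of the logarithmic series; width 1.1e-12). [folklore] -/
theorem log_401_bounds : (5.9939614273061 : ℝ) < Real.log 401 ∧ Real.log 401 < 5.9939614273072 := by
  have hx : |(1 / 401 : ℝ)| < 1 := by rw [abs_of_pos (by norm_num)]; norm_num
  have h := Real.abs_log_sub_add_sum_range_le hx 5
  have hN : Real.log (400 : ℝ) = 4 * Real.log 2 + 2 * Real.log 5 := by
    rw [show (400 : ℝ) = 2 ^ 4 * 5 ^ 2 by norm_num]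
    rw [Real.log_mul (by positivity) (by positivity)]
    simp only [Real.log_pow]; push_cast; ring
  have e : Real.log (1 - 1 / 401 : ℝ) = (4 * Real.log 2 + 2 * Real.log 5) - Real.log 401 := by
    rw [show (1 - 1 / 401 : ℝ) = (400 : ℝ) / 401 by norm_num, Real.log_div (by norm_num) (by norm_num), hN]
  rw [e, abs_of_pos (by norm_num : (0:ℝ) < 1 / 401)] at h
  obtain ⟨hl, hu⟩ := abs_le.1 h
  simp only [Finset.sum_range_succ, Finset.sum_range_zero] at hl hu
  norm_num at hl hu
  have hb2 := log_two_bounds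
  have hb5 := log_five_bounds
  constructor <;> linarith

/-- `6.0137151560423 < log 409 < 6.0137151560435` (from `log(408 / 409)` by 5 terms of the logarithmic series; width 1.2e-12). [folklore] -/
theorem log_409_bounds : (6.0137151560423 : ℝ) < Real.log 409 ∧ Real.log 409 < 6.0137151560435 := by
  have hx : |(1 / 409 : ℝ)| < 1 := by rw [abs_of_pos (by norm_num)]; norm_num
  have h := Real.abs_log_sub_add_sum_range_le hx 5
  have hN : Real.log (408 : ℝ) = 3 * Real.log 2 + Real.log 3 + Real.log 17 := by
    rw [show (408 : ℝ) = 2 ^ 3 * 3 * 17 by norm_num]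
    rw [Real.log_mul (by positivity) (by positivity), Real.log_mul (by positivity) (by positivity)]
    simp only [Real.log_pow]; push_cast; ring
  have e : Real.log (1 - 1 / 409 : ℝ) = (3 * Real.log 2 + Real.log 3 + Real.log 17) - Real.log 409 := by
    rw [show (1 - 1 / 409 : ℝ) = (408 : ℝ) / 409 by norm_num, Real.log_div (by norm_num) (by norm_num), hN]
  rw [e, abs_of_pos (by norm_num : (0:ℝ) < 1 / 409)] at h
  obtain ⟨hl, hu⟩ := abs_le.1 h
  simp only [Finset.sum_range_succ, Finset.sum_range_zero] at hl hu
  norm_num at hl hu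
  have hb2 := log_two_bounds
  have hb3 := log_three_bounds
  have hb17 := log_seventeen_bounds
  constructor <;> linarith

/-- `6.0378709199215 < log 419 < 6.0378709199230` (from `log(418 / 419)` by 5 terms of the logarithmic series; width 1.5e-12). [folklore] -/
theorem log_419_bounds : (6.0378709199215 : ℝ) < Real.log 419 ∧ Real.log 419 < 6.0378709199230 := by
  have hx : |(1 / 419 : ℝ)| < 1 := by rw [abs_of_pos (by norm_num)]; norm_num
  have h := Real.abs_log_sub_add_sum_range_le hx 5
  have hN : Real.log (418 : ℝ) = Real.log 2 + Real.log 11 + Real.log 19 := by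
    rw [show (418 : ℝ) = 2 * 11 * 19 by norm_num]
    rw [Real.log_mul (by positivity) (by positivity), Real.log_mul (by positivity) (by positivity)]
  have e : Real.log (1 - 1 / 419 : ℝ) = (Real.log 2 + Real.log 11 + Real.log 19) - Real.log 419 := by
    rw [show (1 - 1 / 419 : ℝ) = (418 : ℝ) / 419 by norm_num, Real.log_div (by norm_num) (by norm_num), hN]
  rw [e, abs_of_pos (by norm_num : (0:ℝ) < 1 / 419)] at h
  obtain ⟨hl, hu⟩ := abs_le.1 h
  simp only [Finset.sum_range_succ, Finset.sum_range_zero] at hl hu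
  norm_num at hl hu
  have hb2 := log_two_bounds
  have hb11 := log_eleven_bounds
  have hb19 := log_nineteen_bounds
  constructor <;> linarith

/-- `6.0426328336817 < log 421 < 6.0426328336833` (from `log(421 / 422)` by 5 terms of the logarithmic series; width 1.6e-12). [folklore] -/
theorem log_421_bounds : (6.0426328336817 : ℝ) < Real.log 421 ∧ Real.log 421 < 6.0426328336833 := by
  have hx : |(1 / 422 : ℝ)| < 1 := by rw [abs_of_pos (by norm_num)]; norm_num
  have h := Real.abs_log_sub_add_sum_range_le hx 5
  have hN : Real.log (422 : ℝ) = Real.log 2 + Real.log 211 := by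
    rw [show (422 : ℝ) = 2 * 211 by norm_num]
    rw [Real.log_mul (by positivity) (by positivity)]
  have e : Real.log (1 - 1 / 422 : ℝ) = Real.log 421 - (Real.log 2 + Real.log 211) := by
    rw [show (1 - 1 / 422 : ℝ) = (421 : ℝ) / 422 by norm_num, Real.log_div (by norm_num) (by norm_num), hN]
  rw [e, abs_of_pos (by norm_num : (0:ℝ) < 1 / 422)] at h
  obtain ⟨hl, hu⟩ := abs_le.1 h
  simp only [Finset.sum_range_succ, Finset.sum_range_zero] at hl hu
  norm_num at hl hu
  have hb2 := log_two_bounds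
  have hb211 := log_211_bounds
  constructor <;> linarith

/-- `6.0661080901032 < log 431 < 6.0661080901046` (from `log(431 / 432)` by 5 terms of the logarithmic series; width 1.4e-12). [folklore] -/
theorem log_431_bounds : (6.0661080901032 : ℝ) < Real.log 431 ∧ Real.log 431 < 6.0661080901046 := by
  have hx : |(1 / 432 : ℝ)| < 1 := by rw [abs_of_pos (by norm_num)]; norm_num
  have h := Real.abs_log_sub_add_sum_range_le hx 5
  have hN : Real.log (432 : ℝ) = 4 * Real.log 2 + 3 * Real.log 3 := by
    rw [show (432 : ℝ) = 2 ^ 4 * 3 ^ 3 by norm_num]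
    rw [Real.log_mul (by positivity) (by positivity)]
    simp only [Real.log_pow]; push_cast; ring
  have e : Real.log (1 - 1 / 432 : ℝ) = Real.log 431 - (4 * Real.log 2 + 3 * Real.log 3) := by
    rw [show (1 - 1 / 432 : ℝ) = (431 : ℝ) / 432 by norm_num, Real.log_div (by norm_num) (by norm_num), hN]
  rw [e, abs_of_pos (by norm_num : (0:ℝ) < 1 / 432)] at h
  obtain ⟨hl, hu⟩ := abs_le.1 h
  simp only [Finset.sum_range_succ, Finset.sum_range_zero] at hl hu
  norm_num at hl hu
  have hb2 := log_two_bounds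
  have hb3 := log_three_bounds
  constructor <;> linarith

/-- `6.0707377280019 < log 433 < 6.0707377280034` (from `log(431 / 433)` by 5 terms of the logarithmic series; width 1.5e-12). [folklore] -/
theorem log_433_bounds : (6.0707377280019 : ℝ) < Real.log 433 ∧ Real.log 433 < 6.0707377280034 := by
  have hx : |(2 / 433 : ℝ)| < 1 := by rw [abs_of_pos (by norm_num)]; norm_num
  have h := Real.abs_log_sub_add_sum_range_le hx 5
  have e : Real.log (1 - 2 / 433 : ℝ) = (Real.log 431) - Real.log 433 := by
    rw [show (1 - 2 / 433 : ℝ) = (431 : ℝ) / 433 by norm_num, Real.log_div (by norm_num) (by norm_num)]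
  rw [e, abs_of_pos (by norm_num : (0:ℝ) < 2 / 433)] at h
  obtain ⟨hl, hu⟩ := abs_le.1 h
  simp only [Finset.sum_range_succ, Finset.sum_range_zero] at hl hu
  norm_num at hl hu
  have hb431 := log_431_bounds
  constructor <;> linarith

/-- `6.0844994130745 < log 439 < 6.0844994130761` (from `log(437 / 439)` by 5 terms of the logarithmic series; width 1.6e-12). [folklore] -/
theorem log_439_bounds : (6.0844994130745 : ℝ) < Real.log 439 ∧ Real.log 439 < 6.0844994130761 := by
  have hx : |(2 / 439 : ℝ)| < 1 := by rw [abs_of_pos (by norm_num)]; norm_num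
  have h := Real.abs_log_sub_add_sum_range_le hx 5
  have hN : Real.log (437 : ℝ) = Real.log 19 + Real.log 23 := by
    rw [show (437 : ℝ) = 19 * 23 by norm_num]
    rw [Real.log_mul (by positivity) (by positivity)]
  have e : Real.log (1 - 2 / 439 : ℝ) = (Real.log 19 + Real.log 23) - Real.log 439 := by
    rw [show (1 - 2 / 439 : ℝ) = (437 : ℝ) / 439 by norm_num, Real.log_div (by norm_num) (by norm_num), hN]
  rw [e, abs_of_pos (by norm_num : (0:ℝ) < 2 / 439)] at h
  obtain ⟨hl, hu⟩ := abs_le.1 h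
  simp only [Finset.sum_range_succ, Finset.sum_range_zero] at hl hu
  norm_num at hl hu
  have hb19 := log_nineteen_bounds
  have hb23 := log_twentythree_bounds
  constructor <;> linarith

/-- `6.0935697700444 < log 443 < 6.0935697700459` (from `log(441 / 443)` by 5 terms of the logarithmic series; width 1.5e-12). [folklore] -/
theorem log_443_bounds : (6.0935697700444 : ℝ) < Real.log 443 ∧ Real.log 443 < 6.0935697700459 := by
  have hx : |(2 / 443 : ℝ)| < 1 := by rw [abs_of_pos (by norm_num)]; norm_num
  have h := Real.abs_log_sub_add_sum_range_le hx 5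
  have hN : Real.log (441 : ℝ) = 2 * Real.log 3 + 2 * Real.log 7 := by
    rw [show (441 : ℝ) = 3 ^ 2 * 7 ^ 2 by norm_num]
    rw [Real.log_mul (by positivity) (by positivity)]
    simp only [Real.log_pow]; push_cast; ring
  have e : Real.log (1 - 2 / 443 : ℝ) = (2 * Real.log 3 + 2 * Real.log 7) - Real.log 443 := by
    rw [show (1 - 2 / 443 : ℝ) = (441 : ℝ) / 443 by norm_num, Real.log_div (by norm_num) (by norm_num), hN]
  rw [e, abs_of_pos (by norm_num : (0:ℝ) < 2 / 443)] at h
  obtain ⟨hl, hu⟩ := abs_le.1 h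
  simp only [Finset.sum_range_succ, Finset.sum_range_zero] at hl hu
  norm_num at hl hu
  have hb3 := log_three_bounds
  have hb7 := log_seven_bounds
  constructor <;> linarith

/-- `6.1070228877416 < log 449 < 6.1070228877432` (from `log(447 / 449)` by 5 terms of the logarithmic series; width 1.6e-12). [folklore] -/
theorem log_449_bounds : (6.1070228877416 : ℝ) < Real.log 449 ∧ Real.log 449 < 6.1070228877432 := by
  have hx : |(2 / 449 : ℝ)| < 1 := by rw [abs_of_pos (by norm_num)]; norm_num
  have h := Real.abs_log_sub_add_sum_range_le hx 5
  have hN : Real.log (447 : ℝ) = Real.log 3 + Real.log 149 := by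
    rw [show (447 : ℝ) = 3 * 149 by norm_num]
    rw [Real.log_mul (by positivity) (by positivity)]
  have e : Real.log (1 - 2 / 449 : ℝ) = (Real.log 3 + Real.log 149) - Real.log 449 := by
    rw [show (1 - 2 / 449 : ℝ) = (447 : ℝ) / 449 by norm_num, Real.log_div (by norm_num) (by norm_num), hN]
  rw [e, abs_of_pos (by norm_num : (0:ℝ) < 2 / 449)] at h
  obtain ⟨hl, hu⟩ := abs_le.1 h
  simp only [Finset.sum_range_succ, Finset.sum_range_zero] at hl hu
  norm_num at hl hu
  have hb3 := log_three_bounds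
  have hb149 := log_149_bounds
  constructor <;> linarith

/-- `6.1246833908936 < log 457 < 6.1246833908950` (from `log(457 / 458)` by 5 terms of the logarithmic series; width 1.4e-12). [folklore] -/
theorem log_457_bounds : (6.1246833908936 : ℝ) < Real.log 457 ∧ Real.log 457 < 6.1246833908950 := by
  have hx : |(1 / 458 : ℝ)| < 1 := by rw [abs_of_pos (by norm_num)]; norm_num
  have h := Real.abs_log_sub_add_sum_range_le hx 5
  have hN : Real.log (458 : ℝ) = Real.log 2 + Real.log 229 := by
    rw [show (458 : ℝ) = 2 * 229 by norm_num]
    rw [Real.log_mul (by positivity) (by positivity)]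
  have e : Real.log (1 - 1 / 458 : ℝ) = Real.log 457 - (Real.log 2 + Real.log 229) := by
    rw [show (1 - 1 / 458 : ℝ) = (457 : ℝ) / 458 by norm_num, Real.log_div (by norm_num) (by norm_num), hN]
  rw [e, abs_of_pos (by norm_num : (0:ℝ) < 1 / 458)] at h
  obtain ⟨hl, hu⟩ := abs_le.1 h
  simp only [Finset.sum_range_succ, Finset.sum_range_zero] at hl hu
  norm_num at hl hu
  have hb2 := log_two_bounds
  have hb229 := log_229_bounds
  constructor <;> linarith

end Summit.RiemannHypothesis.RiemannHypothesis.Theorems.DbrWall.LogTable
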